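import Literature.Barriers.CriticalPhenomena.PlaquetteWalkHoleRootExtremeColumns
import HarnessLib

/-!
# Barrier catalogue (SAWScalingLimit): CHAINS of side-sharing plaquettes — a doubly visited plaquette lies strictly inside a horizontal
and a vertical chain whose ends are ISOLATED TURNS («KISS CHAINS»)

`Z → ∞` limit model of the printed Yang–Baxter weights [GlazmanManolescu2019, §1, eq. (1)]; the «RECTANGLE COEFFICIENT» line of the
venture lane «pcv-sawmu» (b-engine-1 g26), structural input for (R2) «no doubly visited plaquette».

A plaquette of a Yang–Baxter walk carries one arc (straight: `v`; turning: `u₁`/`u₂`) or two turning arcs on complementary corners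
(`w₁`/`w₂`) [GlazmanManolescu2019, §1, Fig. 1]. Say the walk USES the side `s` of the plaquette `c` (`YBWalk.UsesSide`) if an arc lying
in `c` enters or leaves through `s`. A doubly visited plaquette uses all four sides (`usesSide_of_fc_eq`); a plaquette with an unused
side is singly visited (`single_visit_of_not_usesSide`); a plaquette using `s` but not the opposite side carries exactly one arc, a
TURN through `s` (`isolated_of_usesSide_not_opp`). Since consecutive arcs lie in adjacent plaquettes sharing the crossed mid-edge, a
used side `E` of `c` is a used side `W` of the east neighbour unless that side is the walk's start `a` or end `z`
(`usesSide_step_E/W/N/S`). Iterating inside the bounding box: ★★ `chain_E` / `chain_W` / `chain_N` / `chain_S` — from a plaquette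
using `E` the consecutive plaquettes to the east all use `W` and `E` until a plaquette using `W` but not `E` (an isolated turn
through `W`), unless the chain stops earlier at the first plaquette `fc 0` (the walk starting through its `E` side) or at the last
plaquette (the walk ending through its `E` side); the four directions verbatim. Consequence for the lane (module `PlaquetteWalkHoleRootNoKiss`): every `w₁`/`w₂` plaquette of a wound cost-`5` walk
from a hole root needs four isolated turns at the ends of its two chains, which the isolated-turn profile forbids.
[GlazmanManolescu2019 §1 Fig. 1, eq. (1); Lemma 2.1; Glazman2015WeightedSAW Lemma 3.1 (proof, pp. 6–7)]
-/

noncomputable section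

namespace Literature.Probability.RandomPlanarGeometry.SAW.YangBaxter

namespace YBWalk

variable {D : Set Face} {a z : MidEdge} (γ : YBWalk D a z)

/-- **The walk uses the side `s` of the plaquette `c`**: some arc lying in `c` enters or leaves through `s`.
[cite: GlazmanManolescu2019, §1, Fig. 1 (an arc of a rhombus joins two of its sides)] -/
def UsesSide (c : Face) (s : Side) : Prop := ∃ j < γ.arcs.length, γ.fc j = c ∧ (γ.sIn j = s ∨ γ.sOut j = s)

/-- The entry side of an arc is used. [cite: GlazmanManolescu2019, §1, Fig. 1] -/
theorem usesSide_sIn {j : ℕ} (hj : j < γ.arcs.length) : γ.UsesSide (γ.fc j) (γ.sIn j) := ⟨j, hj, rfl, Or.inl rfl⟩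

/-- The exit side of an arc is used. [cite: GlazmanManolescu2019, §1, Fig. 1] -/
theorem usesSide_sOut {j : ℕ} (hj : j < γ.arcs.length) : γ.UsesSide (γ.fc j) (γ.sOut j) := ⟨j, hj, rfl, Or.inr rfl⟩

/-- A used side belongs to a visited plaquette. [cite: GlazmanManolescu2019, §1, Fig. 1] -/
theorem exists_fc_eq_of_usesSide {c : Face} {s : Side} (h : γ.UsesSide c s) : ∃ j < γ.arcs.length, γ.fc j = c := by
  obtain ⟨j, hj, hc, -⟩ := h
  exact ⟨j, hj, hc⟩

/-- ★ **A DOUBLY VISITED PLAQUETTE USES ALL FOUR SIDES** (two arcs in a rhombus are the two complementary corner arcs `w₁`/`w₂`).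
[cite: GlazmanManolescu2019, §1, Fig. 1 (the configurations `w₁`, `w₂`)] -/
theorem usesSide_of_fc_eq {i j : ℕ} (hi : i < γ.arcs.length) (hj : j < γ.arcs.length) (hij : i ≠ j) (he : γ.fc i = γ.fc j)
    (s : Side) : γ.UsesSide (γ.fc i) s := by
  rcases γ.exists_side_of_fc_eq hi hj hij he s with e | e | e | e
  · exact ⟨i, hi, rfl, Or.inl e⟩
  · exact ⟨i, hi, rfl, Or.inr e⟩
  · exact ⟨j, hj, he.symm, Or.inl e⟩
  · exact ⟨j, hj, he.symm, Or.inr e⟩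

/-- ★ **A PLAQUETTE WITH AN UNUSED SIDE IS SINGLY VISITED.** [cite: GlazmanManolescu2019, §1, Fig. 1 (the configurations `u₁`, `u₂`, `v`)] -/
theorem single_visit_of_not_usesSide {c : Face} {s : Side} (hs : ¬γ.UsesSide c s) {i j : ℕ} (hi : i < γ.arcs.length)
    (hj : j < γ.arcs.length) (hci : γ.fc i = c) (hcj : γ.fc j = c) : i = j := by
  by_contra hij
  exact hs (hci ▸ γ.usesSide_of_fc_eq hi hj hij (hci.trans hcj.symm) s)

/-- ★ **THE END OF A CHAIN IS AN ISOLATED TURN**: a plaquette using the side `s` but not the opposite side carries exactly one arc, and that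
arc is a TURN through `s` (a `u₁`/`u₂` plaquette). [cite: GlazmanManolescu2019, §1, Fig. 1 (the configurations `u₁`, `u₂`)] -/
theorem isolated_of_usesSide_not_opp {c : Face} {s : Side} (h1 : γ.UsesSide c s) (h2 : ¬γ.UsesSide c s.opp) :
    ∃ i < γ.arcs.length, γ.fc i = c ∧ (∀ j < γ.arcs.length, γ.fc j = γ.fc i → j = i) ∧ (γ.sIn i = s ∨ γ.sOut i = s) ∧
      γ.sIn i ≠ s.opp ∧ γ.sOut i ≠ s.opp ∧ arcKind (γ.sIn i) (γ.sOut i) ≠ .straight := by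
  obtain ⟨i, hi, hci, hs⟩ := h1
  have hnin : γ.sIn i ≠ s.opp := fun e => h2 ⟨i, hi, hci, Or.inl e⟩
  have hnout : γ.sOut i ≠ s.opp := fun e => h2 ⟨i, hi, hci, Or.inr e⟩
  refine ⟨i, hi, hci, fun j hj he => γ.single_visit_of_not_usesSide h2 hj hi (he.trans hci) hci, hs, hnin, hnout, ?_⟩
  have hne := γ.sIn_ne_sOut hi
  revert hs hnin hnout hne
  cases γ.sIn i <;> cases γ.sOut i <;> cases s <;> decide

/-! ## One step across a used side -/

/-- The exit side of an arc entering through `N` from the plaquette above is `S`. [cite: GlazmanManolescu2019, §1, Fig. 1] -/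
private theorem sOut_pred_eq_S {i : ℕ} (hi : i < γ.arcs.length) (h1 : 1 ≤ i) (hN : γ.sIn i = .N) : γ.sOut (i - 1) = .S := by
  have hp := γ.fc_pred_eq_of_sIn_N hi h1 hN
  obtain ⟨hin, -⟩ := γ.side_sIn_eq_nth hi
  obtain ⟨-, hout⟩ := γ.side_sIn_eq_nth (show i - 1 < γ.arcs.length by omega)
  rw [show i - 1 + 1 = i by omega, ← hin, hp, hN] at hout
  have e : Face.side ((γ.fc i).1, (γ.fc i).2 + 1) (γ.sOut (i - 1)) = Face.side ((γ.fc i).1, (γ.fc i).2 + 1) .S := by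
    rw [hout]; rfl
  exact Face.side_injective _ e

/-- The exit side of an arc entering through `S` from the plaquette below is `N`. [cite: GlazmanManolescu2019, §1, Fig. 1] -/
private theorem sOut_pred_eq_N {i : ℕ} (hi : i < γ.arcs.length) (h1 : 1 ≤ i) (hS : γ.sIn i = .S) : γ.sOut (i - 1) = .N := by
  have hp := γ.fc_pred_eq_of_sIn_S hi h1 hS
  obtain ⟨hin, -⟩ := γ.side_sIn_eq_nth hi
  obtain ⟨-, hout⟩ := γ.side_sIn_eq_nth (show i - 1 < γ.arcs.length by omega)
  rw [show i - 1 + 1 = i by omega, ← hin, hp, hS] at hout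
  have e : Face.side ((γ.fc i).1, (γ.fc i).2 - 1) (γ.sOut (i - 1)) = Face.side ((γ.fc i).1, (γ.fc i).2 - 1) .N := by
    rw [hout]; obtain ⟨x, y⟩ := γ.fc i; simp [Face.side]
  exact Face.side_injective _ e

/-- The entry side of an arc following an exit through `N` is `S`. [cite: GlazmanManolescu2019, §1, Fig. 1] -/
private theorem sIn_succ_eq_S {i : ℕ} (hi : i + 1 < γ.arcs.length) (hN : γ.sOut i = .N) : γ.sIn (i + 1) = .S := by
  have hs := γ.fc_succ_eq_of_sOut_N hi hN
  obtain ⟨-, hout⟩ := γ.side_sIn_eq_nth (show i < γ.arcs.length by omega)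
  obtain ⟨hin, -⟩ := γ.side_sIn_eq_nth hi
  rw [← hout, hs, hN] at hin
  have e : Face.side ((γ.fc i).1, (γ.fc i).2 + 1) (γ.sIn (i + 1)) = Face.side ((γ.fc i).1, (γ.fc i).2 + 1) .S := by
    rw [hin]; rfl
  exact Face.side_injective _ e

/-- The entry side of an arc following an exit through `S` is `N`. [cite: GlazmanManolescu2019, §1, Fig. 1] -/
private theorem sIn_succ_eq_N {i : ℕ} (hi : i + 1 < γ.arcs.length) (hS : γ.sOut i = .S) : γ.sIn (i + 1) = .N := by
  have hs := γ.fc_succ_eq_of_sOut_S hi hS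
  obtain ⟨-, hout⟩ := γ.side_sIn_eq_nth (show i < γ.arcs.length by omega)
  obtain ⟨hin, -⟩ := γ.side_sIn_eq_nth hi
  rw [← hout, hs, hS] at hin
  have e : Face.side ((γ.fc i).1, (γ.fc i).2 - 1) (γ.sIn (i + 1)) = Face.side ((γ.fc i).1, (γ.fc i).2 - 1) .N := by
    rw [hin]; obtain ⟨x, y⟩ := γ.fc i; simp [Face.side]
  exact Face.side_injective _ e

/-- ★ **STEP EAST**: if the walk uses the `E` side of `c`, then either that side is the start (`c = fc 0`, entered through `E`) or the end
(`c` is the last plaquette, left through `E`), or the EAST neighbour of `c` is visited and uses its `W` side.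
[cite: GlazmanManolescu2019, §1, Fig. 1 (consecutive arcs lie in adjacent rhombi)] -/
theorem usesSide_step_E {c : Face} (h : γ.UsesSide c .E) :
    (c = γ.fc 0 ∧ γ.sIn 0 = .E) ∨ (c = γ.fc (γ.arcs.length - 1) ∧ γ.sOut (γ.arcs.length - 1) = .E) ∨
      γ.UsesSide (c.1 + 1, c.2) .W := by
  obtain ⟨j, hj, hcj, hs | hs⟩ := h
  · rcases Nat.eq_zero_or_pos j with rfl | hpos
    · exact Or.inl ⟨hcj.symm, hs⟩
    · obtain ⟨hp, hout⟩ := γ.fc_pred_eq_of_sIn_E hj hpos hs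
      refine Or.inr (Or.inr ⟨j - 1, by omega, ?_, Or.inr hout⟩)
      rw [hp, hcj]
  · by_cases hlast : j + 1 < γ.arcs.length
    · obtain ⟨hsucc, hin⟩ := γ.fc_succ_eq_of_sOut_E hlast hs
      refine Or.inr (Or.inr ⟨j + 1, hlast, ?_, Or.inl hin⟩)
      rw [hsucc, hcj]
    · have hj' : j = γ.arcs.length - 1 := by omega
      subst hj'
      exact Or.inr (Or.inl ⟨hcj.symm, hs⟩)

/-- ★ **STEP WEST**. [cite: GlazmanManolescu2019, §1, Fig. 1 (consecutive arcs lie in adjacent rhombi)] -/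
theorem usesSide_step_W {c : Face} (h : γ.UsesSide c .W) :
    (c = γ.fc 0 ∧ γ.sIn 0 = .W) ∨ (c = γ.fc (γ.arcs.length - 1) ∧ γ.sOut (γ.arcs.length - 1) = .W) ∨
      γ.UsesSide (c.1 - 1, c.2) .E := by
  obtain ⟨j, hj, hcj, hs | hs⟩ := h
  · rcases Nat.eq_zero_or_pos j with rfl | hpos
    · exact Or.inl ⟨hcj.symm, hs⟩
    · obtain ⟨hp, hout⟩ := γ.fc_pred_eq_of_sIn_W hj hpos hs
      refine Or.inr (Or.inr ⟨j - 1, by omega, ?_, Or.inr hout⟩)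
      rw [hp, hcj]
  · by_cases hlast : j + 1 < γ.arcs.length
    · obtain ⟨hsucc, hin⟩ := γ.fc_succ_eq_of_sOut_W hlast hs
      refine Or.inr (Or.inr ⟨j + 1, hlast, ?_, Or.inl hin⟩)
      rw [hsucc, hcj]
    · have hj' : j = γ.arcs.length - 1 := by omega
      subst hj'
      exact Or.inr (Or.inl ⟨hcj.symm, hs⟩)

/-- ★ **STEP NORTH**. [cite: GlazmanManolescu2019, §1, Fig. 1 (consecutive arcs lie in adjacent rhombi)] -/
theorem usesSide_step_N {c : Face} (h : γ.UsesSide c .N) :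
    (c = γ.fc 0 ∧ γ.sIn 0 = .N) ∨ (c = γ.fc (γ.arcs.length - 1) ∧ γ.sOut (γ.arcs.length - 1) = .N) ∨
      γ.UsesSide (c.1, c.2 + 1) .S := by
  obtain ⟨j, hj, hcj, hs | hs⟩ := h
  · rcases Nat.eq_zero_or_pos j with rfl | hpos
    · exact Or.inl ⟨hcj.symm, hs⟩
    · have hp := γ.fc_pred_eq_of_sIn_N hj hpos hs
      refine Or.inr (Or.inr ⟨j - 1, by omega, ?_, Or.inr (γ.sOut_pred_eq_S hj hpos hs)⟩)
      rw [hp, hcj]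
  · by_cases hlast : j + 1 < γ.arcs.length
    · have hsucc := γ.fc_succ_eq_of_sOut_N hlast hs
      refine Or.inr (Or.inr ⟨j + 1, hlast, ?_, Or.inl (γ.sIn_succ_eq_S hlast hs)⟩)
      rw [hsucc, hcj]
    · have hj' : j = γ.arcs.length - 1 := by omega
      subst hj'
      exact Or.inr (Or.inl ⟨hcj.symm, hs⟩)

/-- ★ **STEP SOUTH**. [cite: GlazmanManolescu2019, §1, Fig. 1 (consecutive arcs lie in adjacent rhombi)] -/
theorem usesSide_step_S {c : Face} (h : γ.UsesSide c .S) :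
    (c = γ.fc 0 ∧ γ.sIn 0 = .S) ∨ (c = γ.fc (γ.arcs.length - 1) ∧ γ.sOut (γ.arcs.length - 1) = .S) ∨
      γ.UsesSide (c.1, c.2 - 1) .N := by
  obtain ⟨j, hj, hcj, hs | hs⟩ := h
  · rcases Nat.eq_zero_or_pos j with rfl | hpos
    · exact Or.inl ⟨hcj.symm, hs⟩
    · have hp := γ.fc_pred_eq_of_sIn_S hj hpos hs
      refine Or.inr (Or.inr ⟨j - 1, by omega, ?_, Or.inr (γ.sOut_pred_eq_N hj hpos hs)⟩)
      rw [hp, hcj]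
  · by_cases hlast : j + 1 < γ.arcs.length
    · have hsucc := γ.fc_succ_eq_of_sOut_S hlast hs
      refine Or.inr (Or.inr ⟨j + 1, hlast, ?_, Or.inl (γ.sIn_succ_eq_N hlast hs)⟩)
      rw [hsucc, hcj]
    · have hj' : j = γ.arcs.length - 1 := by omega
      subst hj'
      exact Or.inr (Or.inl ⟨hcj.symm, hs⟩)

/-! ## Chains -/

/-- ★★ **THE CHAIN EASTWARDS.** A plaquette `c` using its `E` side is followed to the east by consecutive visited plaquettes
`c + (1,0), …, c + (M,0)`, all using `W`, all but the last using `E`; the last one EITHER does not use `E` (`M ≥ 1`: an isolated turn through `W`,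
`isolated_of_usesSide_not_opp`), OR is the first plaquette `fc 0` with the walk starting through its `E` side, OR is the last plaquette with the
walk ending through its `E` side (`M ≥ 0` in the last two cases). [cite: GlazmanManolescu2019, §1, Fig. 1] [cite: Glazman2015WeightedSAW, Lemma 3.1 (proof, pp. 6–7)] -/
theorem chain_E {B : ℤ} (hB : ∀ j < γ.arcs.length, (γ.fc j).1 ≤ B) {c : Face} (hc : γ.UsesSide c .E) :
    ∃ M : ℕ, (∀ m : ℕ, 1 ≤ m → m ≤ M → γ.UsesSide (c.1 + m, c.2) .W) ∧ (∀ m : ℕ, m < M → γ.UsesSide (c.1 + m, c.2) .E) ∧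
      ((1 ≤ M ∧ ¬γ.UsesSide (c.1 + M, c.2) .E) ∨ ((c.1 + (M : ℤ), c.2) = γ.fc 0 ∧ γ.sIn 0 = .E) ∨
        ((c.1 + (M : ℤ), c.2) = γ.fc (γ.arcs.length - 1) ∧ γ.sOut (γ.arcs.length - 1) = .E)) := by
  -- induction on the distance to the east wall
  suffices H : ∀ k : ℕ, ∀ c : Face, B - c.1 ≤ k → γ.UsesSide c .E →
      ∃ M : ℕ, (∀ m : ℕ, 1 ≤ m → m ≤ M → γ.UsesSide (c.1 + m, c.2) .W) ∧ (∀ m : ℕ, m < M → γ.UsesSide (c.1 + m, c.2) .E) ∧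
        ((1 ≤ M ∧ ¬γ.UsesSide (c.1 + M, c.2) .E) ∨ ((c.1 + (M : ℤ), c.2) = γ.fc 0 ∧ γ.sIn 0 = .E) ∨
          ((c.1 + (M : ℤ), c.2) = γ.fc (γ.arcs.length - 1) ∧ γ.sOut (γ.arcs.length - 1) = .E)) by
    obtain ⟨j, hj, hcj⟩ := γ.exists_fc_eq_of_usesSide hc
    have hb := hB j hj
    rw [hcj] at hb
    exact H (B - c.1).toNat c (by omega) hc
  intro k
  induction k with
  | zero =>
    intro c hk hc
    rcases γ.usesSide_step_E hc with ⟨e, hs⟩ | ⟨e, hs⟩ | hW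
    · exact ⟨0, fun m h1 h2 => by omega, fun m hm => by omega, Or.inr (Or.inl ⟨by simpa using e, hs⟩)⟩
    · exact ⟨0, fun m h1 h2 => by omega, fun m hm => by omega, Or.inr (Or.inr ⟨by simpa using e, hs⟩)⟩
    · -- the east neighbour would lie beyond the wall
      obtain ⟨j, hj, hcj⟩ := γ.exists_fc_eq_of_usesSide hW
      have hb := hB j hj
      rw [hcj] at hb
      simp only at hb
      omega
  | succ k ih =>
    intro c hk hc
    rcases γ.usesSide_step_E hc with ⟨e, hs⟩ | ⟨e, hs⟩ | hW
    · exact ⟨0, fun m h1 h2 => by omega, fun m hm => by omega, Or.inr (Or.inl ⟨by simpa using e, hs⟩)⟩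
    · exact ⟨0, fun m h1 h2 => by omega, fun m hm => by omega, Or.inr (Or.inr ⟨by simpa using e, hs⟩)⟩
    · by_cases hE : γ.UsesSide (c.1 + 1, c.2) .E
      · obtain ⟨M, hWall, hEall, hend⟩ := ih (c.1 + 1, c.2) (by simp only; omega) hE
        refine ⟨M + 1, fun m hm1 hmM => ?_, fun m hm => ?_, ?_⟩
        · rcases Nat.eq_or_lt_of_le hm1 with h1 | h1
          · rw [← h1]; simpa using hW
          · have := hWall (m - 1) (by omega) (by omega)
            simp only at this
            rwa [show c.1 + 1 + ((m - 1 : ℕ) : ℤ) = c.1 + (m : ℤ) by omega] at this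
        · rcases Nat.eq_zero_or_pos m with rfl | hpos
          · simpa using hc
          · have := hEall (m - 1) (by omega)
            simp only at this
            rwa [show c.1 + 1 + ((m - 1 : ℕ) : ℤ) = c.1 + (m : ℤ) by omega] at this
        · simp only at hend
          rw [show c.1 + 1 + (M : ℤ) = c.1 + ((M + 1 : ℕ) : ℤ) by push_cast; ring] at hend
          rcases hend with ⟨-, hnot⟩ | hA | hZ
          · exact Or.inl ⟨by omega, hnot⟩
          · exact Or.inr (Or.inl hA)
          · exact Or.inr (Or.inr hZ)
      · refine ⟨1, fun m hm1 hm2 => ?_, fun m hm => ?_, Or.inl ⟨le_rfl, by simpa using hE⟩⟩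
        · have : m = 1 := by omega
          subst this; simpa using hW
        · have : m = 0 := by omega
          subst this; simpa using hc

/-- ★★ **THE CHAIN WESTWARDS** (mirror of `chain_E`): cells `c − (1,0), …, c − (M,0)` all using `E`, all but the last using `W`; the last does not use
`W` (`M ≥ 1`), or is `fc 0` entered through `W` at the start, or is the last plaquette left through `W` at the end.
[cite: GlazmanManolescu2019, §1, Fig. 1] [cite: Glazman2015WeightedSAW, Lemma 3.1 (proof, pp. 6–7)] -/
theorem chain_W {B : ℤ} (hB : ∀ j < γ.arcs.length, B ≤ (γ.fc j).1) {c : Face} (hc : γ.UsesSide c .W) :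
    ∃ M : ℕ, (∀ m : ℕ, 1 ≤ m → m ≤ M → γ.UsesSide (c.1 - m, c.2) .E) ∧ (∀ m : ℕ, m < M → γ.UsesSide (c.1 - m, c.2) .W) ∧
      ((1 ≤ M ∧ ¬γ.UsesSide (c.1 - M, c.2) .W) ∨ ((c.1 - (M : ℤ), c.2) = γ.fc 0 ∧ γ.sIn 0 = .W) ∨
        ((c.1 - (M : ℤ), c.2) = γ.fc (γ.arcs.length - 1) ∧ γ.sOut (γ.arcs.length - 1) = .W)) := by
  suffices H : ∀ k : ℕ, ∀ c : Face, c.1 - B ≤ k → γ.UsesSide c .W →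
      ∃ M : ℕ, (∀ m : ℕ, 1 ≤ m → m ≤ M → γ.UsesSide (c.1 - m, c.2) .E) ∧ (∀ m : ℕ, m < M → γ.UsesSide (c.1 - m, c.2) .W) ∧
        ((1 ≤ M ∧ ¬γ.UsesSide (c.1 - M, c.2) .W) ∨ ((c.1 - (M : ℤ), c.2) = γ.fc 0 ∧ γ.sIn 0 = .W) ∨
          ((c.1 - (M : ℤ), c.2) = γ.fc (γ.arcs.length - 1) ∧ γ.sOut (γ.arcs.length - 1) = .W)) by
    obtain ⟨j, hj, hcj⟩ := γ.exists_fc_eq_of_usesSide hc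
    have hb := hB j hj
    rw [hcj] at hb
    exact H (c.1 - B).toNat c (by omega) hc
  intro k
  induction k with
  | zero =>
    intro c hk hc
    rcases γ.usesSide_step_W hc with ⟨e, hs⟩ | ⟨e, hs⟩ | hE
    · exact ⟨0, fun m h1 h2 => by omega, fun m hm => by omega, Or.inr (Or.inl ⟨by simpa using e, hs⟩)⟩
    · exact ⟨0, fun m h1 h2 => by omega, fun m hm => by omega, Or.inr (Or.inr ⟨by simpa using e, hs⟩)⟩
    · obtain ⟨j, hj, hcj⟩ := γ.exists_fc_eq_of_usesSide hE
      have hb := hB j hj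
      rw [hcj] at hb
      simp only at hb
      omega
  | succ k ih =>
    intro c hk hc
    rcases γ.usesSide_step_W hc with ⟨e, hs⟩ | ⟨e, hs⟩ | hE
    · exact ⟨0, fun m h1 h2 => by omega, fun m hm => by omega, Or.inr (Or.inl ⟨by simpa using e, hs⟩)⟩
    · exact ⟨0, fun m h1 h2 => by omega, fun m hm => by omega, Or.inr (Or.inr ⟨by simpa using e, hs⟩)⟩
    · by_cases hW : γ.UsesSide (c.1 - 1, c.2) .W
      · obtain ⟨M, hEall, hWall, hend⟩ := ih (c.1 - 1, c.2) (by simp only; omega) hW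
        refine ⟨M + 1, fun m hm1 hmM => ?_, fun m hm => ?_, ?_⟩
        · rcases Nat.eq_or_lt_of_le hm1 with h1 | h1
          · rw [← h1]; simpa using hE
          · have := hEall (m - 1) (by omega) (by omega)
            simp only at this
            rwa [show c.1 - 1 - ((m - 1 : ℕ) : ℤ) = c.1 - (m : ℤ) by omega] at this
        · rcases Nat.eq_zero_or_pos m with rfl | hpos
          · simpa using hc
          · have := hWall (m - 1) (by omega)
            simp only at this
            rwa [show c.1 - 1 - ((m - 1 : ℕ) : ℤ) = c.1 - (m : ℤ) by omega] at this
        · simp only at hend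
          rw [show c.1 - 1 - (M : ℤ) = c.1 - ((M + 1 : ℕ) : ℤ) by push_cast; ring] at hend
          rcases hend with ⟨-, hnot⟩ | hA | hZ
          · exact Or.inl ⟨by omega, hnot⟩
          · exact Or.inr (Or.inl hA)
          · exact Or.inr (Or.inr hZ)
      · refine ⟨1, fun m hm1 hm2 => ?_, fun m hm => ?_, Or.inl ⟨le_rfl, by simpa using hW⟩⟩
        · have : m = 1 := by omega
          subst this; simpa using hE
        · have : m = 0 := by omega
          subst this; simpa using hc

/-- ★★ **THE CHAIN NORTHWARDS** (mirror of `chain_E`): cells `c + (0,1), …, c + (0,M)` all using `S`, all but the last using `N`; the last does not use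
`N` (`M ≥ 1`), or is `fc 0` entered through `N` at the start, or is the last plaquette left through `N` at the end.
[cite: GlazmanManolescu2019, §1, Fig. 1] [cite: Glazman2015WeightedSAW, Lemma 3.1 (proof, pp. 6–7)] -/
theorem chain_N {B : ℤ} (hB : ∀ j < γ.arcs.length, (γ.fc j).2 ≤ B) {c : Face} (hc : γ.UsesSide c .N) :
    ∃ M : ℕ, (∀ m : ℕ, 1 ≤ m → m ≤ M → γ.UsesSide (c.1, c.2 + m) .S) ∧ (∀ m : ℕ, m < M → γ.UsesSide (c.1, c.2 + m) .N) ∧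
      ((1 ≤ M ∧ ¬γ.UsesSide (c.1, c.2 + M) .N) ∨ ((c.1, c.2 + (M : ℤ)) = γ.fc 0 ∧ γ.sIn 0 = .N) ∨
        ((c.1, c.2 + (M : ℤ)) = γ.fc (γ.arcs.length - 1) ∧ γ.sOut (γ.arcs.length - 1) = .N)) := by
  suffices H : ∀ k : ℕ, ∀ c : Face, B - c.2 ≤ k → γ.UsesSide c .N →
      ∃ M : ℕ, (∀ m : ℕ, 1 ≤ m → m ≤ M → γ.UsesSide (c.1, c.2 + m) .S) ∧ (∀ m : ℕ, m < M → γ.UsesSide (c.1, c.2 + m) .N) ∧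
        ((1 ≤ M ∧ ¬γ.UsesSide (c.1, c.2 + M) .N) ∨ ((c.1, c.2 + (M : ℤ)) = γ.fc 0 ∧ γ.sIn 0 = .N) ∨
          ((c.1, c.2 + (M : ℤ)) = γ.fc (γ.arcs.length - 1) ∧ γ.sOut (γ.arcs.length - 1) = .N)) by
    obtain ⟨j, hj, hcj⟩ := γ.exists_fc_eq_of_usesSide hc
    have hb := hB j hj
    rw [hcj] at hb
    exact H (B - c.2).toNat c (by omega) hc
  intro k
  induction k with
  | zero =>
    intro c hk hc
    rcases γ.usesSide_step_N hc with ⟨e, hs⟩ | ⟨e, hs⟩ | hS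
    · exact ⟨0, fun m h1 h2 => by omega, fun m hm => by omega, Or.inr (Or.inl ⟨by simpa using e, hs⟩)⟩
    · exact ⟨0, fun m h1 h2 => by omega, fun m hm => by omega, Or.inr (Or.inr ⟨by simpa using e, hs⟩)⟩
    · obtain ⟨j, hj, hcj⟩ := γ.exists_fc_eq_of_usesSide hS
      have hb := hB j hj
      rw [hcj] at hb
      simp only at hb
      omega
  | succ k ih =>
    intro c hk hc
    rcases γ.usesSide_step_N hc with ⟨e, hs⟩ | ⟨e, hs⟩ | hS
    · exact ⟨0, fun m h1 h2 => by omega, fun m hm => by omega, Or.inr (Or.inl ⟨by simpa using e, hs⟩)⟩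
    · exact ⟨0, fun m h1 h2 => by omega, fun m hm => by omega, Or.inr (Or.inr ⟨by simpa using e, hs⟩)⟩
    · by_cases hN : γ.UsesSide (c.1, c.2 + 1) .N
      · obtain ⟨M, hSall, hNall, hend⟩ := ih (c.1, c.2 + 1) (by simp only; omega) hN
        refine ⟨M + 1, fun m hm1 hmM => ?_, fun m hm => ?_, ?_⟩
        · rcases Nat.eq_or_lt_of_le hm1 with h1 | h1
          · rw [← h1]; simpa using hS
          · have := hSall (m - 1) (by omega) (by omega)
            simp only at this
            rwa [show c.2 + 1 + ((m - 1 : ℕ) : ℤ) = c.2 + (m : ℤ) by omega] at this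
        · rcases Nat.eq_zero_or_pos m with rfl | hpos
          · simpa using hc
          · have := hNall (m - 1) (by omega)
            simp only at this
            rwa [show c.2 + 1 + ((m - 1 : ℕ) : ℤ) = c.2 + (m : ℤ) by omega] at this
        · simp only at hend
          rw [show c.2 + 1 + (M : ℤ) = c.2 + ((M + 1 : ℕ) : ℤ) by push_cast; ring] at hend
          rcases hend with ⟨-, hnot⟩ | hA | hZ
          · exact Or.inl ⟨by omega, hnot⟩
          · exact Or.inr (Or.inl hA)
          · exact Or.inr (Or.inr hZ)
      · refine ⟨1, fun m hm1 hm2 => ?_, fun m hm => ?_, Or.inl ⟨le_rfl, by simpa using hN⟩⟩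
        · have : m = 1 := by omega
          subst this; simpa using hS
        · have : m = 0 := by omega
          subst this; simpa using hc

/-- ★★ **THE CHAIN SOUTHWARDS** (mirror of `chain_N`): cells `c − (0,1), …, c − (0,M)` all using `N`, all but the last using `S`; the last does not use
`S` (`M ≥ 1`), or is `fc 0` entered through `S` at the start, or is the last plaquette left through `S` at the end.
[cite: GlazmanManolescu2019, §1, Fig. 1] [cite: Glazman2015WeightedSAW, Lemma 3.1 (proof, pp. 6–7)] -/
theorem chain_S {B : ℤ} (hB : ∀ j < γ.arcs.length, B ≤ (γ.fc j).2) {c : Face} (hc : γ.UsesSide c .S) :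
    ∃ M : ℕ, (∀ m : ℕ, 1 ≤ m → m ≤ M → γ.UsesSide (c.1, c.2 - m) .N) ∧ (∀ m : ℕ, m < M → γ.UsesSide (c.1, c.2 - m) .S) ∧
      ((1 ≤ M ∧ ¬γ.UsesSide (c.1, c.2 - M) .S) ∨ ((c.1, c.2 - (M : ℤ)) = γ.fc 0 ∧ γ.sIn 0 = .S) ∨
        ((c.1, c.2 - (M : ℤ)) = γ.fc (γ.arcs.length - 1) ∧ γ.sOut (γ.arcs.length - 1) = .S)) := by
  suffices H : ∀ k : ℕ, ∀ c : Face, c.2 - B ≤ k → γ.UsesSide c .S →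
      ∃ M : ℕ, (∀ m : ℕ, 1 ≤ m → m ≤ M → γ.UsesSide (c.1, c.2 - m) .N) ∧ (∀ m : ℕ, m < M → γ.UsesSide (c.1, c.2 - m) .S) ∧
        ((1 ≤ M ∧ ¬γ.UsesSide (c.1, c.2 - M) .S) ∨ ((c.1, c.2 - (M : ℤ)) = γ.fc 0 ∧ γ.sIn 0 = .S) ∨
          ((c.1, c.2 - (M : ℤ)) = γ.fc (γ.arcs.length - 1) ∧ γ.sOut (γ.arcs.length - 1) = .S)) by
    obtain ⟨j, hj, hcj⟩ := γ.exists_fc_eq_of_usesSide hc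
    have hb := hB j hj
    rw [hcj] at hb
    exact H (c.2 - B).toNat c (by omega) hc
  intro k
  induction k with
  | zero =>
    intro c hk hc
    rcases γ.usesSide_step_S hc with ⟨e, hs⟩ | ⟨e, hs⟩ | hN
    · exact ⟨0, fun m h1 h2 => by omega, fun m hm => by omega, Or.inr (Or.inl ⟨by simpa using e, hs⟩)⟩
    · exact ⟨0, fun m h1 h2 => by omega, fun m hm => by omega, Or.inr (Or.inr ⟨by simpa using e, hs⟩)⟩
    · obtain ⟨j, hj, hcj⟩ := γ.exists_fc_eq_of_usesSide hN
      have hb := hB j hj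
      rw [hcj] at hb
      simp only at hb
      omega
  | succ k ih =>
    intro c hk hc
    rcases γ.usesSide_step_S hc with ⟨e, hs⟩ | ⟨e, hs⟩ | hN
    · exact ⟨0, fun m h1 h2 => by omega, fun m hm => by omega, Or.inr (Or.inl ⟨by simpa using e, hs⟩)⟩
    · exact ⟨0, fun m h1 h2 => by omega, fun m hm => by omega, Or.inr (Or.inr ⟨by simpa using e, hs⟩)⟩
    · by_cases hS' : γ.UsesSide (c.1, c.2 - 1) .S
      · obtain ⟨M, hNall, hSall, hend⟩ := ih (c.1, c.2 - 1) (by simp only; omega) hS'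
        refine ⟨M + 1, fun m hm1 hmM => ?_, fun m hm => ?_, ?_⟩
        · rcases Nat.eq_or_lt_of_le hm1 with h1 | h1
          · rw [← h1]; simpa using hN
          · have := hNall (m - 1) (by omega) (by omega)
            simp only at this
            rwa [show c.2 - 1 - ((m - 1 : ℕ) : ℤ) = c.2 - (m : ℤ) by omega] at this
        · rcases Nat.eq_zero_or_pos m with rfl | hpos
          · simpa using hc
          · have := hSall (m - 1) (by omega)
            simp only at this
            rwa [show c.2 - 1 - ((m - 1 : ℕ) : ℤ) = c.2 - (m : ℤ) by omega] at this
        · simp only at hend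
          rw [show c.2 - 1 - (M : ℤ) = c.2 - ((M + 1 : ℕ) : ℤ) by push_cast; ring] at hend
          rcases hend with ⟨-, hnot⟩ | hA | hZ
          · exact Or.inl ⟨by omega, hnot⟩
          · exact Or.inr (Or.inl hA)
          · exact Or.inr (Or.inr hZ)
      · refine ⟨1, fun m hm1 hm2 => ?_, fun m hm => ?_, Or.inl ⟨le_rfl, by simpa using hS'⟩⟩
        · have : m = 1 := by omega
          subst this; simpa using hN
        · have : m = 0 := by omega
          subst this; simpa using hc

end YBWalk

end Literature.Probability.RandomPlanarGeometry.SAW.YangBaxter
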